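import Summits.CriticalPhenomena.PercolationContinuityZ3.Theorems.Transplant.SiteZ2Encoding
import HarnessLib

/-!
# Site percolation on `ℤ²`: dual box crossings bounded below force `θ^{site}(t) = 0`

builds on p205010 (kernel theorem, internal audit signed; external expert review pending).

Helper file (`--supports stmt-CriticalPhenomena-4575`) for `SitePercolationContinuity 2`. This is
Harris' square-annulus argument (Bollobás–Riordan 2006, Ch. 3, Thm. 6) run for the bond encoding
`SiteZ2.law (zdGraph 2) t` of site percolation (`SiteZ2Encoding.lean`), verbatim after the tree's
`PercMonotoneFactorsClassNoJumpPlanarAnnulus.lean` (there for block-factor laws):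

* `exists_rowSegment_bound` — the dual measure `(law t)* = (law t) ∘ dualConfig⁻¹` has the row
  finite-energy bound `(law t)*(L consecutive dual bonds open) ≥ p₀^L` with
  `p₀ = (law t)*(one dual bond) ≥ 1 - t > 0` (positive association, translation invariance);
* `exists_dual_long_crossing_bound` — if the short-way dual crossings `𝓒₁(N, 8N)` have probability
  `≥ ε > 0` at all large scales, the weak Köhler-Schindler–Tassion RSW theorem for the dual
  (`weakPeriodicRSW_one_one`, all steps proved in the tree) bounds the long dual crossings
  `𝓒₁(4N, N)` below by some `c > 0` at all large scales;
* `siteTheta_eq_zero_of_dual_crossings` — then each square annulus `{n ≤ ‖z‖_∞ ≤ 3n}`, `n = m 4ᵏ`,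
  is blocked with probability `≥ c⁴` (`pow_four_le_real_annulusBlocked_of`, generic in the tree),
  the annuli read pairwise disjoint sets of sites and are therefore independent under the encoded
  law (`real_biInter_law_eq_prod`), and a percolating lattice configuration lies in none of them:
  `θ^{site}(t) ≤ (1 - c⁴)^K → 0`.

## References

* B. Bollobás, O. Riordan, *Percolation*, CUP (2006), Ch. 3, Thm. 6.
* L. Köhler-Schindler, V. Tassion, Duke Math. J. 172 (2023), Theorem 1 and Comment 1.
* T. E. Harris, Proc. Cambridge Philos. Soc. 56 (1960) 13–20.
-/

noncomputable section

namespace Summit.CriticalPhenomena.PercolationContinuityZ3.Theorems.Transplant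

namespace SiteZ2

open MeasureTheory ProbabilityTheory Literature.Probability.Percolation
  Literature.Probability.LatticeModels KSTPeriodic Filter
open Summit.CriticalPhenomena.PercolationContinuityZ3.Theorems.PercMonotoneFactorsClassNoJumpPlanar
open scoped Topology

/-! ### Row finite energy of the dual measure -/

/-- **Row finite energy of the dual encoded law** (`t < 1`): with
`p₀ = (law t)*(the dual bond {(0,0),(1,0)} is open) ≥ 1 - t > 0`, every row segment of `L` dual
bonds is open with probability `≥ p₀^L` (translation invariance and positive association of the
dual measure). [cite: KohlerSchindlerTassion2023, Theorem 1 (finite-energy input of the weak form)] -/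
theorem exists_rowSegment_bound {t : unitInterval} (ht1 : (t : ℝ) < 1) :
    ∃ p₀ : ℝ, 0 < p₀ ∧ ∃ y : ℤ, ∀ (a : ℤ) (L : ℕ), p₀ ^ L ≤
      ((law (zdGraph 2) t).map dualConfig).real
        {ω | ∀ i : ℕ, i < L → s(![a + i, y], ![a + i + 1, y]) ∈ ω} := by
  haveI := isProbabilityMeasure_map_dualConfig (law (zdGraph 2) t)
  have hadm := admissible_map_dualConfig (admissible_law t)
  set ν' := (law (zdGraph 2) t).map dualConfig with hν'
  set p₀ : ℝ := ν'.real {ω | s((![0, 0] : Site 2), ![1, 0]) ∈ ω} with hp₀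
  refine ⟨p₀, lt_of_lt_of_le (by linarith) (one_sub_le_real_dual_bond t), 0, fun a L => ?_⟩
  -- positive association over the `L` bonds, each of probability `p₀`
  have hev : {ω : BondConfig (Site 2) | ∀ i : ℕ, i < L → s(![a + i, (0 : ℤ)], ![a + i + 1, 0]) ∈ ω} =
      ⋂ i ∈ Finset.range L, {ω | s(![a + i, (0 : ℤ)], ![a + i + 1, 0]) ∈ ω} := by
    ext ω; simp
  have hfkg := hadm.posAssoc.finset_prod_le_biInter (Finset.range L)
    (A := fun i : ℕ => {ω : BondConfig (Site 2) | s(![a + i, (0 : ℤ)], ![a + i + 1, 0]) ∈ ω})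
    (fun i _ => fun ω ω' hle h => hle h) (fun i _ => measurableSet_mem _)
  have hfkg' := ENNReal.toReal_mono (measure_ne_top _ _) hfkg
  rw [ENNReal.toReal_prod] at hfkg'
  rw [hev, measureReal_def]
  refine le_trans (le_of_eq ?_) hfkg'
  rw [Finset.prod_congr rfl fun i _ => ?_, Finset.prod_const, Finset.card_range]
  show ν'.real {ω | s(![a + i, (0 : ℤ)], ![a + i + 1, 0]) ∈ ω} = p₀
  have e1 : (![a + (i : ℤ), (0 : ℤ)] : Site 2) = ![0, 0] + ![a + (i : ℤ), 0] := by
    ext j; fin_cases j <;> simp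
  have e2 : (![a + (i : ℤ) + 1, (0 : ℤ)] : Site 2) = ![1, 0] + ![a + (i : ℤ), 0] := by
    ext j; fin_cases j <;> simp; ring
  rw [hp₀, ← real_mk_add_mem hadm ![0, 0] ![1, 0] ![a + (i : ℤ), 0], ← e1, ← e2]

/-! ### Long dual crossings from short ones -/

/-- **Long dual crossings are bounded below**: if `(law t)*(𝓒₁(N, 8N)) ≥ ε > 0` for all `N ≥ N₀`
then `(law t)*(𝓒₁(4N, N)) ≥ c > 0` for all large `N` (weak periodic RSW for the dual measure, with
its row finite energy). [cite: KohlerSchindlerTassion2023, Theorem 1 and Comment 1] -/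
theorem exists_dual_long_crossing_bound {t : unitInterval} (ht1 : (t : ℝ) < 1) {ε : ℝ} (hε : 0 < ε)
    {N₀ : ℕ} (hcross : ∀ N : ℕ, N₀ ≤ N →
      ε ≤ ((law (zdGraph 2) t).map dualConfig).real (crossing 1 N (8 * N))) :
    ∃ c : ℝ, 0 < c ∧ ∃ N₁ : ℕ, ∀ N : ℕ, N₁ ≤ N →
      c ≤ ((law (zdGraph 2) t).map dualConfig).real (crossing 1 (4 * N) N) := by
  haveI := isProbabilityMeasure_map_dualConfig (law (zdGraph 2) t)
  obtain ⟨p₀, hp₀, y, hrow⟩ := exists_rowSegment_bound ht1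
  obtain ⟨c, hc, N₁, h⟩ := weakPeriodicRSW_one_one ε p₀ hε hp₀ N₀ 4 (by norm_num)
  exact ⟨c, hc, N₁, fun N hN => h _ (admissible_map_dualConfig (admissible_law t))
    (latticeCarried_map_dualConfig _) (fun N hN _ => hcross N hN) ⟨y, hrow⟩ N hN⟩

/-! ### Independence of the annuli along the scales `m 4ᵏ` and the conclusion -/

/-- The annuli `{n_k - 1 < ‖·‖_∞ ≤ 3 n_k}` along the scales `n_j = m 4ʲ` (`m ≥ 3`) are pairwise
disjoint. [folklore] -/
theorem disjoint_annulus {m k l : ℕ} (hm : 3 ≤ m) (hkl : k ≠ l) :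
    Disjoint (annulus 2 (m * 4 ^ k - 1) (3 * (m * 4 ^ k))) (annulus 2 (m * 4 ^ l - 1) (3 * (m * 4 ^ l))) := by
  rw [Finset.disjoint_left]
  intro x hx hx'
  obtain ⟨i, hi⟩ := exists_lt_abs_sub_of_mem_annulus (R := 0) (by omega) hkl hx hx'
  simp at hi

/-- **Dual box crossings bounded below force `θ^{site}(t) = 0`** (`t < 1`): if the short-way dual
crossings `𝓒₁(N, 8N)` of the dual encoded law have probability `≥ ε > 0` for all `N ≥ N₀`, then
`θ^{site}_{ℤ²}(t) = 0`. Square-annulus argument: the annuli at the scales `m 4ᵏ` are blocked with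
probability `≥ c⁴` each, independently. [cite: BollobasRiordan2006, Ch. 3, Thm. 6] -/
theorem siteTheta_eq_zero_of_dual_crossings {t : unitInterval} (ht1 : (t : ℝ) < 1) {ε : ℝ}
    (hε : 0 < ε) {N₀ : ℕ}
    (hcross : ∀ N : ℕ, N₀ ≤ N →
      ε ≤ ((law (zdGraph 2) t).map dualConfig).real (KSTPeriodic.crossing 1 N (8 * N))) :
    siteTheta (zdGraph 2) (0 : Site 2) t = 0 := by
  haveI := isProbabilityMeasure_map_dualConfig (law (zdGraph 2) t)
  have hadm := admissible_law t
  have hL := latticeCarried_law t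
  have hL' := latticeCarried_map_dualConfig (law (zdGraph 2) t)
  obtain ⟨c, hc, N₁, hlong⟩ := exists_dual_long_crossing_bound ht1 hε hcross
  set ν := law (zdGraph 2) t with hν
  -- the scales `n_k = m 4^k`
  set m : ℕ := N₁ + 4 with hm
  have hm3 : 3 ≤ m := by omega
  have hmN : N₁ + 4 ≤ m := le_rfl
  have hn : ∀ k : ℕ, m ≤ m * 4 ^ k := fun k => Nat.le_mul_of_pos_right m (Nat.one_le_pow _ _ (by norm_num))
  -- each annulus is blocked with probability `≥ c⁴`
  have hblock : ∀ k : ℕ, c ^ 4 ≤ ν.real (annulusBlocked (m * 4 ^ k)) := by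
    intro k
    have hnk := hn k
    refine pow_four_le_real_annulusBlocked_of hadm hL hc.le (by omega) ?_
    have h1 := hlong (m * 4 ^ k - 1) (by omega)
    refine h1.trans (real_crossing_mono hL' (by omega) le_rfl)
  -- independence along the scales
  have hprod : ∀ K : ℕ, ν.real (⋂ k ∈ Finset.range K, (annulusBlocked (m * 4 ^ k))ᶜ) =
      ∏ k ∈ Finset.range K, ν.real (annulusBlocked (m * 4 ^ k))ᶜ := by
    intro K
    refine real_biInter_law_eq_prod t (Finset.range K)
      (A := fun k => (annulusBlocked (m * 4 ^ k))ᶜ)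
      (fun k _ => (measurableSet_annulusBlocked _).compl)
      (K := fun k => ↑((annulus 2 (m * 4 ^ k - 1) (3 * (m * 4 ^ k))).sym2))
      (fun k _ => determinedBy_compl_annulusBlocked (by have := hn k; omega))
      (T := fun k => annulus 2 (m * 4 ^ k - 1) (3 * (m * 4 ^ k)))
      (fun k _ e he z hz => ?_) (fun k _ l _ hkl => disjoint_annulus hm3 hkl)
    rw [Finset.mem_coe, Finset.mem_sym2_iff] at he
    exact he z hz
  -- the bound `θ^{site}(t) ≤ (1 - c⁴)^K`
  have hc1 : c ^ 4 ≤ 1 := (hblock 0).trans measureReal_le_one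
  have hbound : ∀ K : ℕ, siteTheta (zdGraph 2) (0 : Site 2) t ≤ (1 - c ^ 4) ^ K := by
    intro K
    calc siteTheta (zdGraph 2) (0 : Site 2) t = ν.real (percolatesAt 0) :=
          (real_law_percolatesAt t 0).symm
      _ ≤ ν.real (⋂ k ∈ Finset.range K, (annulusBlocked (m * 4 ^ k))ᶜ) := by
          refine ENNReal.toReal_mono (measure_ne_top _ _) (measure_mono_ae ?_)
          filter_upwards [hL] with ω hω hperc
          change ω ∈ ⋂ k ∈ Finset.range K, (annulusBlocked (m * 4 ^ k))ᶜ
          simp only [Set.mem_iInter, Set.mem_compl_iff, Finset.mem_range]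
          intro k _ hB
          exact not_mem_percolatesAt_of_annulusBlocked hω (by have := hn k; omega) hB hperc
      _ = ∏ k ∈ Finset.range K, ν.real (annulusBlocked (m * 4 ^ k))ᶜ := hprod K
      _ = ∏ k ∈ Finset.range K, (1 - ν.real (annulusBlocked (m * 4 ^ k))) :=
          Finset.prod_congr rfl fun k _ => probReal_compl_eq_one_sub (measurableSet_annulusBlocked _)
      _ ≤ ∏ _k ∈ Finset.range K, (1 - c ^ 4) :=
          Finset.prod_le_prod (fun k _ => sub_nonneg.2 measureReal_le_one)
            (fun k _ => by linarith [hblock k])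
      _ = (1 - c ^ 4) ^ K := by rw [Finset.prod_const, Finset.card_range]
  have hlim : Tendsto (fun K : ℕ => (1 - c ^ 4) ^ K) atTop (𝓝 0) :=
    tendsto_pow_atTop_nhds_zero_of_lt_one (sub_nonneg.2 hc1) (sub_lt_self 1 (pow_pos hc 4))
  exact le_antisymm (ge_of_tendsto' hlim hbound) (by unfold siteTheta; exact measureReal_nonneg)

end SiteZ2

end Summit.CriticalPhenomena.PercolationContinuityZ3.Theorems.Transplant

end
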